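import Summits.CriticalPhenomena.CardyFormulaZ2.Theorems.CardyUSTContinuationKirchhoffExtremalLengthG02CrossMid

/-!
# The crosscut loop: the column, the shadows of `Γ_V`, and the two exits (G02 discretisation)

Support file for `KirchhoffExtremalLength` (route CardyUSTContinuation of `CardyFormulaZ2`, item
stmt-CriticalPhenomena-11234), towards the upper half of `G02ModulusConvergence` (`…Defs.lean`).
Steps 1–2 of the tree's `SquareTiling.exists_exits_flux_eq` ([GP19] §3) for
`Ω_δ = discreteDomainGraph Ω δ`: for all small meshes, the lattice column through the straight
middle piece of `Γ_V` consists of inner faces containing the base face `⌊c⋆/δ⌋`, and following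
the shadows of the two halves of `Γ_V` — prolonged beyond the end points `q_b = Γ_V 0`,
`q_t = Γ_V 1` along the exterior closing curves `E_b`, `E_t` until a square containing an
exterior point (for `Ω_δ`, only such squares are known not to be inner faces) — produces two
exits `(p_b, n_b)`, `(p_t, n_t)` of the face component of the base together with lattice walks
from the ends of the column to `p_b`, `p_t` inside the component, whose squares touch the outer
pieces of `Γ_V` or points `θ`-close to `q_b`, `q_t`, the outer squares `n_b`, `n_t` touching
points `θ`-close to `q_b`, `q_t`.
-/

noncomputable section

namespace Summit.CriticalPhenomena.CardyFormulaZ2.Theorems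

namespace KirchhoffSlope

open Set Metric Filter Topology SimpleGraph
open Literature.Probability Literature.Probability.LatticeModels Literature.Probability.Percolation
open Literature.Probability.LatticeModels.SquareTiling (closedSq floorSq mem_closedSq_floorSq floorSq_mk upRun
  mem_support_upRun exists_dualWalk_of_path near_of_shadow lineMap_props dist_le_of_mem_closedSq)
open Literature.Probability.RandomPlanarGeometry

variable {δ : ℝ}

/-- **The column, the shadows of `Γ_V`, and the two exits.** See the file header.
[cite: GeorgakopoulosPanagiotis2019, §3 (duality, on `ℤ²`)] -/
theorem exists_crosscut_walks (R : ConformalRectangle) {ΓV : ℝ → ℂ} {c₀ : ℂ} {r xs ys tᵢ tₒ : ℝ}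
    (hVc : ContinuousOn ΓV (Icc 0 1)) (htᵢ : 0 < tᵢ) (htᵢₒ : tᵢ < tₒ) (htₒ : tₒ < 1)
    (hVΩ : ∀ t ∈ Ioo (0 : ℝ) 1, ΓV t ∈ R.carrier) (hr : 0 < r) (hballΩ : closedBall c₀ r ⊆ R.carrier)
    (hxs : |xs - c₀.re| < r / 5) (hys : |ys - c₀.im| < r / 5)
    (hA234 : segment ℝ (ΓV tᵢ) ⟨xs, c₀.im - r / 2⟩ ∪ segment ℝ ⟨xs, c₀.im - r / 2⟩ ⟨xs, c₀.im + r / 2⟩ ∪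
      segment ℝ ⟨xs, c₀.im + r / 2⟩ (ΓV tₒ) ⊆ closedBall c₀ r)
    {Et Eb : ℝ → ℂ} (hEtc : ContinuousOn Et (Icc 1 2)) (hEbc : ContinuousOn Eb (Icc 1 2))
    (hEt1 : Et 1 = ΓV 1) (hEb1 : Eb 1 = ΓV 0) (hEt : ∀ t ∈ Ioc (1 : ℝ) 2, Et t ∈ (closure R.carrier)ᶜ)
    (hEb : ∀ t ∈ Ioc (1 : ℝ) 2, Eb t ∈ (closure R.carrier)ᶜ) {θ : ℝ} (hθ : 0 < θ) :
    ∃ δ₀ > 0, ∀ δ, 0 < δ → δ < δ₀ → ∃ (Cm : Site 2) (K : ℕ),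
      ⌊(c₀.re - r / 2) / δ⌋ + 1 ≤ Cm 0 ∧ Cm 0 ≤ ⌊(c₀.re + r / 2) / δ⌋ ∧ Cm 1 ≤ ⌊ys / δ⌋ ∧ ⌊ys / δ⌋ + 1 ≤ Cm 1 + K ∧
      (∀ q ∈ (upRun Cm K).support, IsInnerFace R.carrier δ q) ∧
      (![⌊xs / δ⌋, ⌊ys / δ⌋] : Site 2) ∈ (upRun Cm K).support ∧
      (∀ q ∈ (upRun Cm K).support, ∃ x ∈ segment ℝ (⟨xs, c₀.im - r / 2⟩ : ℂ) ⟨xs, c₀.im + r / 2⟩, x ∈ closedSq δ q) ∧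
      ∃ pb nb pt nt : Site 2, (zdGraph 2).Adj pb nb ∧ (zdGraph 2).Adj pt nt ∧
      ∃ (w₁ : (zdGraph 2).Walk Cm pb) (u₁ : (zdGraph 2).Walk (Cm + (K : ℤ) • Pi.single 1 1) pt),
        (∀ z ∈ w₁.support, (faceGraph R.carrier δ).Reachable ![⌊xs / δ⌋, ⌊ys / δ⌋] z) ∧
        (∀ z ∈ u₁.support, (faceGraph R.carrier δ).Reachable ![⌊xs / δ⌋, ⌊ys / δ⌋] z) ∧
        ¬ (faceGraph R.carrier δ).Reachable ![⌊xs / δ⌋, ⌊ys / δ⌋] nb ∧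
        ¬ (faceGraph R.carrier δ).Reachable ![⌊xs / δ⌋, ⌊ys / δ⌋] nt ∧
        (∀ q ∈ w₁.support, (∃ x ∈ ΓV '' Icc 0 tᵢ ∪ segment ℝ (ΓV tᵢ) ⟨xs, c₀.im - r / 2⟩ ∪
            segment ℝ ⟨xs, c₀.im + r / 2⟩ (ΓV tₒ) ∪ ΓV '' Icc tₒ 1, x ∈ closedSq δ q) ∨
          ∃ x ∈ closedSq δ q, dist x (ΓV 0) < θ) ∧
        (∀ q ∈ u₁.support, (∃ x ∈ ΓV '' Icc 0 tᵢ ∪ segment ℝ (ΓV tᵢ) ⟨xs, c₀.im - r / 2⟩ ∪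
            segment ℝ ⟨xs, c₀.im + r / 2⟩ (ΓV tₒ) ∪ ΓV '' Icc tₒ 1, x ∈ closedSq δ q) ∨
          ∃ x ∈ closedSq δ q, dist x (ΓV 1) < θ) ∧
        (∃ x ∈ closedSq δ nb, dist x (ΓV 0) < θ) ∧ (∃ x ∈ closedSq δ nt, dist x (ΓV 1) < θ) := by
  set qb := ΓV 0 with hqbdef
  set qt := ΓV 1 with hqtdef
  set Qvm : ℂ := ⟨xs, c₀.im - r / 2⟩ with hQvm
  set Qvp : ℂ := ⟨xs, c₀.im + r / 2⟩ with hQvp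
  set A1 : Set ℂ := ΓV '' Icc 0 tᵢ with hA1
  set A2 : Set ℂ := segment ℝ (ΓV tᵢ) Qvm with hA2
  set A4 : Set ℂ := segment ℝ Qvp (ΓV tₒ) with hA4
  set A5 : Set ℂ := ΓV '' Icc tₒ 1 with hA5
  have hIcc1 : ∀ {u v : ℝ}, 0 ≤ u → v ≤ 1 → Icc u v ⊆ Icc 0 1 := fun hu hv => Icc_subset_Icc hu hv
  have hA1c : IsCompact A1 := (isCompact_Icc.image_of_continuousOn (hVc.mono (hIcc1 le_rfl (htᵢₒ.le.trans htₒ.le))))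
  have hA5c : IsCompact A5 := (isCompact_Icc.image_of_continuousOn (hVc.mono (hIcc1 (htᵢ.le.trans htᵢₒ.le) le_rfl)))
  -- ### constants: compact parts of `A1`, `A5` away from the end points, the ball, the closing curves
  set K₁ : Set ℂ := A1 ∩ (ball qb (θ / 2))ᶜ with hK₁
  set K₅ : Set ℂ := A5 ∩ (ball qt (θ / 2))ᶜ with hK₅
  have hK₁Ω : K₁ ⊆ R.carrier := by
    rintro z ⟨⟨t, ht, rfl⟩, hz⟩
    rcases ht.1.eq_or_lt with h | h
    · exfalso; apply hz; rw [← h]; exact mem_ball_self (by positivity)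
    · exact hVΩ t ⟨h, ht.2.trans_lt (htᵢₒ.trans htₒ)⟩
  have hK₅Ω : K₅ ⊆ R.carrier := by
    rintro z ⟨⟨t, ht, rfl⟩, hz⟩
    rcases ht.2.lt_or_eq with h | h
    · exact hVΩ t ⟨(htᵢ.trans htᵢₒ).trans_le ht.1, h⟩
    · exfalso; apply hz; rw [h]; exact mem_ball_self (by positivity)
  obtain ⟨δK₁, hδK₁, hinnK₁⟩ := exists_forall_isInnerFace_of_near R.toJordanDomain (hA1c.inter_right isOpen_ball.isClosed_compl) hK₁Ω
  obtain ⟨δK₅, hδK₅, hinnK₅⟩ := exists_forall_isInnerFace_of_near R.toJordanDomain (hA5c.inter_right isOpen_ball.isClosed_compl) hK₅Ω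
  obtain ⟨δKb, hδKb, hinnKb⟩ := exists_forall_isInnerFace_of_near R.toJordanDomain (isCompact_closedBall c₀ r) hballΩ
  obtain ⟨t₁, ht₁, Ht₁⟩ := exists_start_param hEtc hEt (ε := θ / 2) (by positivity)
  obtain ⟨t₂, ht₂, Ht₂⟩ := exists_start_param hEbc hEb (ε := θ / 2) (by positivity)
  refine ⟨min (min δK₁ δK₅) (min δKb (r / 16)), by positivity, fun δ hδ hδlt => ?_⟩
  have hδK₁' : δ < δK₁ := hδlt.trans_le ((min_le_left _ _).trans (min_le_left _ _))
  have hδK₅' : δ < δK₅ := hδlt.trans_le ((min_le_left _ _).trans (min_le_right _ _))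
  have hδKb' : δ < δKb := hδlt.trans_le ((min_le_right _ _).trans (min_le_left _ _))
  have hδr : 16 * δ < r := by have := hδlt.trans_le ((min_le_right _ _).trans (min_le_right _ _)); linarith
  -- ### indices and the column
  set Xs : ℤ := ⌊xs / δ⌋ with hXs
  set Ys : ℤ := ⌊ys / δ⌋ with hYs
  set Ym : ℤ := ⌊(c₀.im - r / 2) / δ⌋ with hYm
  set Yp : ℤ := ⌊(c₀.im + r / 2) / δ⌋ with hYp
  have hxs' := abs_lt.1 hxs
  have hys' := abs_lt.1 hys
  have hfl : ∀ {u v : ℝ}, u + 2 * δ ≤ v → ⌊u / δ⌋ + 1 ≤ ⌊v / δ⌋ := by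
    intro u v huv
    have : u / δ + 2 ≤ v / δ := by rw [div_add' _ _ _ hδ.ne', div_le_div_iff_of_pos_right hδ]; linarith
    have h1 := Int.floor_le_floor this
    rw [show u / δ + 2 = u / δ + ((2 : ℤ) : ℝ) by push_cast; ring, Int.floor_add_intCast] at h1
    omega
  have hYmYs : Ym + 1 ≤ Ys := hfl (by linarith)
  have hYsYp : Ys + 1 ≤ Yp := hfl (by linarith)
  have hXmXs : ⌊(c₀.re - r / 2) / δ⌋ + 1 ≤ Xs := hfl (by linarith)
  have hXsXp : Xs + 1 ≤ ⌊(c₀.re + r / 2) / δ⌋ := hfl (by linarith)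
  set k : ℕ := (Yp - Ym).toNat with hk
  have hkz : (k : ℤ) = Yp - Ym := Int.toNat_of_nonneg (by omega)
  set Cm : Site 2 := ![Xs, Ym] with hCm
  set p₀ : Site 2 := ![Xs, Ys] with hp₀def
  have hCmfl : floorSq δ Qvm = Cm := by rw [hQvm, floorSq_mk]
  have hCpfl : Cm + (k : ℤ) • (Pi.single 1 1 : Site 2) = floorSq δ Qvp := by
    rw [hQvp, floorSq_mk]; ext i; fin_cases i <;> simp [hCm, hkz, hYp, hXs]
  have hinK : ∀ q : Site 2, (∃ w ∈ closedBall c₀ r, w ∈ closedSq δ q) → IsInnerFace R.carrier δ q := hinnKb δ hδ hδKb'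
  have hcoltouch := column_touch hδ hr hxs hδr (c₀ := c₀)
  have hcol_inner : ∀ q ∈ (upRun Cm k).support, IsInnerFace R.carrier δ q := fun q hq => hinK q (hcoltouch q hq).1
  have hp₀col : p₀ ∈ (upRun Cm k).support := by
    rw [mem_support_upRun]; simp [hp₀def, hCm]; omega
  have hp₀inner : IsInnerFace R.carrier δ p₀ := hcol_inner p₀ hp₀col
  have hcol_reach : ∀ q ∈ (upRun Cm k).support, (faceGraph R.carrier δ).Reachable p₀ q := fun q hq =>
    reachable_of_mem_support_inner (upRun Cm k) hcol_inner hp₀col hq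
  -- reachable squares are inner; exits are not inner; squares with exterior points are not reachable
  have hreach_inner : ∀ {q : Site 2}, (faceGraph R.carrier δ).Reachable p₀ q → IsInnerFace R.carrier δ q := fun hq => by
    obtain ⟨W⟩ := hq; exact isInnerFace_of_mem_support' hp₀inner W (Walk.end_mem_support _)
  have hexit_notinner : ∀ {p n : Site 2}, (faceGraph R.carrier δ).Reachable p₀ p → (zdGraph 2).Adj p n →
      ¬ (faceGraph R.carrier δ).Reachable p₀ n → ¬ IsInnerFace R.carrier δ n := fun hp hpn hn hnI =>
    hn (hp.trans (faceGraph_adj_iff.2 ⟨hpn, hreach_inner hp, hnI⟩).reachable)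
  have hfloor_notreach : ∀ {z : ℂ}, z ∈ (closure R.carrier)ᶜ → ¬ (faceGraph R.carrier δ).Reachable p₀ (floorSq δ z) :=
    fun hz hr' => not_isInnerFace_of_mem_closedSq R hδ (mem_closedSq_floorSq hδ _) hz (hreach_inner hr')
  -- ### the shadows of the pieces of `Γ_V` and of the starts of the closing curves
  obtain ⟨ω₁, -, hω₁s⟩ := exists_dualWalk_of_path hδ htᵢ.le (hVc.mono (hIcc1 le_rfl (htᵢₒ.le.trans htₒ.le)))
    (P := floorSq δ qb) (P' := floorSq δ (ΓV tᵢ)) (mem_closedSq_floorSq hδ _) (mem_closedSq_floorSq hδ _)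
  obtain ⟨hL₂c, hL₂0, hL₂1, hL₂im⟩ := lineMap_props (ΓV tᵢ) Qvm
  obtain ⟨ω₂, -, hω₂s⟩ := exists_dualWalk_of_path hδ zero_le_one hL₂c (P := floorSq δ (ΓV tᵢ)) (P' := Cm)
    (by show AffineMap.lineMap _ _ (0 : ℝ) ∈ _; rw [hL₂0]; exact mem_closedSq_floorSq hδ _)
    (by show AffineMap.lineMap _ _ (1 : ℝ) ∈ _; rw [hL₂1, ← hCmfl]; exact mem_closedSq_floorSq hδ _)
  obtain ⟨hL₄c, hL₄0, hL₄1, hL₄im⟩ := lineMap_props Qvp (ΓV tₒ)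
  obtain ⟨ω₄, -, hω₄s⟩ := exists_dualWalk_of_path hδ zero_le_one hL₄c (P := floorSq δ Qvp) (P' := floorSq δ (ΓV tₒ))
    (by show AffineMap.lineMap _ _ (0 : ℝ) ∈ _; rw [hL₄0]; exact mem_closedSq_floorSq hδ _)
    (by show AffineMap.lineMap _ _ (1 : ℝ) ∈ _; rw [hL₄1]; exact mem_closedSq_floorSq hδ _)
  obtain ⟨ω₅, -, hω₅s⟩ := exists_dualWalk_of_path hδ htₒ.le (hVc.mono (hIcc1 (htᵢ.le.trans htᵢₒ.le) le_rfl))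
    (P := floorSq δ (ΓV tₒ)) (P' := floorSq δ qt) (mem_closedSq_floorSq hδ _) (mem_closedSq_floorSq hδ _)
  obtain ⟨ωE, -, hωEs⟩ := exists_dualWalk_of_path hδ ht₁.1.le (hEtc.mono (Icc_subset_Icc le_rfl ht₁.2))
    (P := floorSq δ qt) (P' := floorSq δ (Et t₁)) (by rw [← hEt1]; exact mem_closedSq_floorSq hδ _) (mem_closedSq_floorSq hδ _)
  obtain ⟨ωE', -, hωE's⟩ := exists_dualWalk_of_path hδ ht₂.1.le (hEbc.mono (Icc_subset_Icc le_rfl ht₂.2))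
    (P := floorSq δ qb) (P' := floorSq δ (Eb t₂)) (by rw [← hEb1]; exact mem_closedSq_floorSq hδ _) (mem_closedSq_floorSq hδ _)
  have hnear₁ : ∀ q ∈ ω₁.support, ∃ x ∈ A1, x ∈ closedSq δ q := fun q hq => near_of_shadow hω₁s hq
  have hnear₂ : ∀ q ∈ ω₂.support, ∃ x ∈ A2, x ∈ closedSq δ q := fun q hq => by
    have := near_of_shadow hω₂s hq; rwa [hL₂im] at this
  have hnear₄ : ∀ q ∈ ω₄.support, ∃ x ∈ A4, x ∈ closedSq δ q := fun q hq => by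
    have := near_of_shadow hω₄s hq; rwa [hL₄im] at this
  have hnear₅ : ∀ q ∈ ω₅.support, ∃ x ∈ A5, x ∈ closedSq δ q := fun q hq => near_of_shadow hω₅s hq
  have hnearE : ∀ q ∈ ωE.support, ∃ x ∈ closedSq δ q, dist x qt < θ := fun q hq => by
    obtain ⟨t, ht, hx⟩ := hωEs q hq
    refine ⟨Et t, hx, ?_⟩
    rcases ht.1.eq_or_lt with h | h
    · rw [← h, hEt1, hqtdef, _root_.dist_self]; exact hθ
    · rw [← hEt1]; linarith [(Ht₁ t ⟨h, ht.2⟩).2]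
  have hnearE' : ∀ q ∈ ωE'.support, ∃ x ∈ closedSq δ q, dist x qb < θ := fun q hq => by
    obtain ⟨t, ht, hx⟩ := hωE's q hq
    refine ⟨Eb t, hx, ?_⟩
    rcases ht.1.eq_or_lt with h | h
    · rw [← h, hEb1, hqbdef, _root_.dist_self]; exact hθ
    · rw [← hEb1]; linarith [(Ht₂ t ⟨h, ht.2⟩).2]
  -- ### the exits
  set ωR := (ω₄.append ω₅).append ωE with hωR
  set ωL := (ω₁.append ω₂).reverse.append ωE' with hωL
  have hstartR : (faceGraph R.carrier δ).Reachable p₀ (floorSq δ Qvp) := by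
    rw [← hCpfl]; exact hcol_reach _ (Walk.end_mem_support _)
  have hstartL : (faceGraph R.carrier δ).Reachable p₀ Cm := hcol_reach _ (Walk.start_mem_support _)
  obtain ⟨pt, nt, hptnt, u₁, u₂, -, hu₁F, hntF, hnt_supp, hu₁supp⟩ :=
    exists_exit_decomp ωR hstartR (hfloor_notreach (Ht₁ t₁ ⟨ht₁.1, le_rfl⟩).1)
  obtain ⟨pb, nb, hpbnb, w₁, w₂, -, hw₁F, hnbF, hnb_supp, hw₁supp⟩ :=
    exists_exit_decomp ωL hstartL (hfloor_notreach (Ht₂ t₂ ⟨ht₂.1, le_rfl⟩).1)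
  have hptF : (faceGraph R.carrier δ).Reachable p₀ pt := hu₁F _ (Walk.end_mem_support _)
  have hpbF : (faceGraph R.carrier δ).Reachable p₀ pb := hw₁F _ (Walk.end_mem_support _)
  have hnt_ni : ¬ IsInnerFace R.carrier δ nt := hexit_notinner hptF hptnt hntF
  have hnb_ni : ¬ IsInnerFace R.carrier δ nb := hexit_notinner hpbF hpbnb hnbF
  -- what the squares of `ωR`, `ωL` touch; non-inner ones are `θ`-close to `q_t`, `q_b`
  have hRtouch : ∀ q ∈ ωR.support, (∃ x ∈ A1 ∪ A2 ∪ A4 ∪ A5, x ∈ closedSq δ q) ∨ ∃ x ∈ closedSq δ q, dist x qt < θ := by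
    intro q hq
    rw [hωR, Walk.mem_support_append_iff, Walk.mem_support_append_iff] at hq
    rcases hq with (h | h) | h
    · obtain ⟨x, hx, hxq⟩ := hnear₄ q h; exact Or.inl ⟨x, Or.inl (Or.inr hx), hxq⟩
    · obtain ⟨x, hx, hxq⟩ := hnear₅ q h; exact Or.inl ⟨x, Or.inr hx, hxq⟩
    · exact Or.inr (hnearE q h)
  have hLtouch : ∀ q ∈ ωL.support, (∃ x ∈ A1 ∪ A2 ∪ A4 ∪ A5, x ∈ closedSq δ q) ∨ ∃ x ∈ closedSq δ q, dist x qb < θ := by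
    intro q hq
    rw [hωL, Walk.mem_support_append_iff, Walk.support_reverse, List.mem_reverse, Walk.mem_support_append_iff] at hq
    rcases hq with (h | h) | h
    · obtain ⟨x, hx, hxq⟩ := hnear₁ q h; exact Or.inl ⟨x, Or.inl (Or.inl (Or.inl hx)), hxq⟩
    · obtain ⟨x, hx, hxq⟩ := hnear₂ q h; exact Or.inl ⟨x, Or.inl (Or.inl (Or.inr hx)), hxq⟩
    · exact Or.inr (hnearE' q h)
  have hRni : ∀ q ∈ ωR.support, ¬ IsInnerFace R.carrier δ q → ∃ x ∈ closedSq δ q, dist x qt < θ := by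
    intro q hq hni
    rw [hωR, Walk.mem_support_append_iff, Walk.mem_support_append_iff] at hq
    rcases hq with (h | h) | h
    · obtain ⟨x, hx, hxq⟩ := hnear₄ q h
      exact (hni (hinK q ⟨x, hA234 (Or.inr hx), hxq⟩)).elim
    · obtain ⟨x, hx, hxq⟩ := hnear₅ q h
      refine ⟨x, hxq, ?_⟩
      by_contra hfar
      push Not at hfar
      exact hni (hinnK₅ δ hδ hδK₅' q ⟨x, ⟨hx, fun hb => by rw [Metric.mem_ball] at hb; linarith⟩, hxq⟩)
    · exact hnearE q h
  have hLni : ∀ q ∈ ωL.support, ¬ IsInnerFace R.carrier δ q → ∃ x ∈ closedSq δ q, dist x qb < θ := by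
    intro q hq hni
    rw [hωL, Walk.mem_support_append_iff, Walk.support_reverse, List.mem_reverse, Walk.mem_support_append_iff] at hq
    rcases hq with (h | h) | h
    · obtain ⟨x, hx, hxq⟩ := hnear₁ q h
      refine ⟨x, hxq, ?_⟩
      by_contra hfar
      push Not at hfar
      exact hni (hinnK₁ δ hδ hδK₁' q ⟨x, ⟨hx, fun hb => by rw [Metric.mem_ball] at hb; linarith⟩, hxq⟩)
    · obtain ⟨x, hx, hxq⟩ := hnear₂ q h
      exact (hni (hinK q ⟨x, hA234 (Or.inl (Or.inl hx)), hxq⟩)).elim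
    · exact hnearE' q h
  -- ### conclusion
  refine ⟨Cm, k, by simpa [hCm] using hXmXs, by simp [hCm]; omega, by simp [hCm]; omega, by simp [hCm, hkz]; omega,
    hcol_inner, hp₀col, fun q hq => (hcoltouch q hq).2, pb, nb, pt, nt, hpbnb, hptnt, w₁, u₁.copy hCpfl.symm rfl,
    hw₁F, fun z hz => hu₁F z (by rwa [Walk.support_copy] at hz), hnbF, hntF,
    fun q hq => hLtouch q (hw₁supp q hq), fun q hq => hRtouch q (hu₁supp q (by rwa [Walk.support_copy] at hq)),
    hLni nb hnb_supp hnb_ni, hRni nt hnt_supp hnt_ni⟩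

end KirchhoffSlope

end Summit.CriticalPhenomena.CardyFormulaZ2.Theorems
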